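import Literature.Computability.QuantumComplexity.MatrixProductStateCut
import Mathlib.LinearAlgebra.Matrix.Kronecker
import HarnessLib

/-!
# Overlaps and matrix elements of matrix product states: the environment recursion and the
  transfer operator (Pérez-García–Verstraete–Wolf–Cirac 2007 §2.1; Schollwöck 2011 §4.2.1–4.2.2)

Topic `Literature/Computability/QuantumComplexity` (pub-qadeq lane; companion of
`MatrixProductStateCut.lean`). HONEST FRAMING: instance-level adjudication of specific advantage
claims; no claim about BQP vs BPP or the summit. Nothing here says anything about any particular
state, engine or cost; the file proves, once, the contraction rule by which every number an MPS
engine reports (norms, fidelities between two MPS, local expectation values, two-site correlators)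
is computed — so that 'engine A's χ = 512 state has fidelity F with engine B's' is a statement about
a definite finite matrix product.

## The printed statements

* Overlap of two open-boundary MPS with matrices `M̃`, `M`:
  '`⟨φ|ψ⟩ = Σ_σ M̃^{σ₁*} ⋯ M̃^{σ_L*} M^{σ₁} ⋯ M^{σ_L}`' and its regrouping
  '`⟨φ|ψ⟩ = Σ_{σ_L} M̃^{σ_L†}( ⋯ (Σ_{σ₂} M̃^{σ₂†}(Σ_{σ₁} M̃^{σ₁†} M^{σ₁}) M^{σ₂}) ⋯ ) M^{σ_L}`'
  [cite: Schollwoeck2011AnnPhys, §4.2 first display and §4.2.1 first display], read as 'an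
  iterative update of a matrix … We now introduce matrices `C^{[ℓ]}`, where `C^{[0]}` is a dummy
  matrix, being the scalar 1. Then an overlap `⟨φ|ψ⟩` can be carried out iteratively by running `ℓ`
  from 1 through `L`: `C^{[ℓ]} = Σ_{σ_ℓ} M̃^{σ_ℓ†} C^{[ℓ-1]} M^{σ_ℓ}`, where `C^{[L]}` will be a scalar
  again, containing the result. For operators taken between the two states, the natural extension
  of this approach is `C^{[ℓ]} = Σ_{σ_ℓ,σ'_ℓ} O^{σ_ℓ,σ'_ℓ} M̃^{σ_ℓ†} C^{[ℓ-1]} M^{σ'_ℓ}`.'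
  [cite: Schollwoeck2011AnnPhys, §4.2.1, the two `C^{[ℓ]}` displays].
* The transfer operator: '`Ê^{[ℓ]} = … (Σ_{σ_ℓ} M^{[ℓ]σ_ℓ*} ⊗ M^{[ℓ]σ_ℓ}) …`'
  [cite: Schollwoeck2011AnnPhys, §4.2.2 display defining `Ê^{[ℓ]}`]; 'Normalization as well as
  other expectation values of product operators can be obtained from
  `⟨ψ| ⊗_{k=1}^N S_k |ψ⟩ = tr[Π_{k=1}^N E^{[k]}_{S_k}]`, with
  `E_S^{[k]} ≡ Σ_{i,j=1}^d ⟨i|S|j⟩ Ā_i^{[k]} ⊗ A_j^{[k]}`'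
  [cite: PerezGarciaVerstraeteWolfCiracQIC2007, §2.1 display after 'its MPS representation is not
  unique'] (printed for the trace form; here the open-boundary form, boundary vectors in place of
  the trace — the amplitudes are those of `MatrixProductStateCut.lean`).
* Operator strings act tensor-by-tensor: 'when applying unitary `V` … we need only update `Γ^{[C]}`'
  / '`Γ'^{[l]i}_{αβ} = Σ_{j} U^i_j Γ^{[l]j}_{αβ}`' [cite: Vidal2003, Lemma 1 and its proof display].

## Contents (all proved, 0 named facts)

* §1 `MPS.crossGram A B l l'` — the environment matrix `C_{a,b} = ⟨a_A | b_B⟩` of the left blocks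
  of two MPS (for `A = B`, `l = l'` it is `leftGram` of `MatrixProductStateCut.lean`:
  `leftGram_eq_crossGram`); `crossGram_zero` (`C^{(0)} = l̄ l'ᵀ`), **`crossGram_succ`**
  (`C^{(k+1)} = Σ_σ A_k(σ)† C^{(k)} B_k(σ)`, the printed recursion) and
  **`braket_amplitude_eq_crossGram`** (`⟨ψ_A|ψ_B⟩ = r̄ ⬝ C^{(n)} r'`, the final contraction with the
  right boundary vectors).
* §2 the transfer-operator form: `MPS.transferOp A B i = Σ_σ conj(A_i(σ)) ⊗ₖ B_i(σ)` (Mathlib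
  Kronecker product on `χ × χ'`), **`crossGramVec_succ`** (the recursion is right-multiplication
  of the vectorised environment by `transferOp`), **`crossGramVec_eq_vecMul_prod`**
  (`vec C^{(n)} = (l̄ ⊗ l') ᵥ* Π_i E_i`) and **`braket_amplitude_eq_transfer`**
  (`⟨ψ_A|ψ_B⟩ = (l̄ ⊗ l') ⬝ (Π_i E_i) (r̄ ⊗ r')`).
* §3 operator strings: `MPS.opWeight O s s' = Π_i O_i(s_i, s'_i)`, `MPS.absorb O B`
  (`B_i(σ) ↦ Σ_{σ'} O_i(σ,σ') B_i(σ')`), **`transfer_absorb`** (the product–sum interchange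
  `Π_i Σ_{σ'} O_i(s_i,σ') B_i(σ') = Σ_{s'} (Π_i O_i(s_i,s'_i)) Π_i B_i(s'_i)`), **`amplitude_absorb`**
  (an operator string maps an MPS to an MPS with the SAME bond index type),
  **`matrixElement_eq_braket_absorb`** (`⟨ψ_A| ⊗_i O_i |ψ_B⟩ = ⟨ψ_A | ψ_{absorb O B}⟩`, so §1–§2 apply
  with `E^O_i = Σ_{σ,σ'} O_i(σ,σ') conj(A_i(σ)) ⊗ₖ B_i(σ')`: `transferOp_absorb`).

Not covered: the mixed-canonical shortcut `⟨ψ|Ô^{[ℓ]}|ψ⟩ = Σ O^{σσ'} tr(M^{σ†}M^{σ'})` (needs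
right-normalisation as well), operation counts (`O(L D³ d)`), periodic boundary conditions, MPOs.

## References

* [Schollwoeck2011AnnPhys] U. Schollwöck, Ann. Phys. 326, 96 (2011) = arXiv:1008.3477, §4.2 and
  §4.2.1 (overlap displays, the `C^{[ℓ]}` recursion with and without operators), §4.2.2 (transfer
  operator `Ê^{[ℓ]} = Σ_σ M^{σ*} ⊗ M^{σ}`). Read via `lit read arxiv:1008.3477` (chunks p0022–p0023).
* [PerezGarciaVerstraeteWolfCiracQIC2007] D. Pérez-García, F. Verstraete, M. M. Wolf, J. I. Cirac,
  Quantum Inf. Comput. 7, 401 (2007) = quant-ph/0608197, §2.1 (`E_S^{[k]}`; 'Normalization as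
  well as other expectation values of product operators'). Read via `lit read
  arxiv:quant-ph/0608197` (chunk p0003).
* [Vidal2003] G. Vidal, PRL 91, 147902 (2003) = quant-ph/0301063, Lemma 1 (a one-site gate only
  transforms `Γ^{[l]}`). Read via `lit read arxiv:quant-ph/0301063` (chunk p0003).
-/

noncomputable section

open Finset Matrix
open scoped ComplexConjugate Kronecker

namespace Literature.Computability.QuantumComplexity

namespace MPS

variable {σ χ χ' : Type*} [Fintype σ] [Fintype χ] [DecidableEq χ] [Fintype χ'] [DecidableEq χ']

/-! ### §1 The environment ("C-matrix") recursion for overlaps -/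

section CrossGram

variable {k : ℕ}

/-- The environment matrix of two MPS after `k` sites: `C_{a,b} = ⟨a_A|b_B⟩ = Σ_s conj(|a⟩_A(s)) |b⟩_B(s)`,
the cross-Gram matrix of the left block vectors of `(A, l)` and `(B, l')`.
[cite: Schollwoeck2011AnnPhys, §4.2.1 ('We now introduce matrices `C^{[ℓ]}` …')] -/
def crossGram (A : Fin k → σ → Matrix χ χ ℂ) (B : Fin k → σ → Matrix χ' χ' ℂ) (l : χ → ℂ)
    (l' : χ' → ℂ) : Matrix χ χ' ℂ :=
  Matrix.of fun a b => braket (leftBlock A l a) (leftBlock B l' b)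

/-- Entries of the environment matrix. [cite: Schollwoeck2011AnnPhys, §4.2.1] -/
theorem crossGram_apply (A : Fin k → σ → Matrix χ χ ℂ) (B : Fin k → σ → Matrix χ' χ' ℂ)
    (l : χ → ℂ) (l' : χ' → ℂ) (a : χ) (b : χ') :
    crossGram A B l l' a b = braket (leftBlock A l a) (leftBlock B l' b) := rfl

/-- The Gram matrix of `MatrixProductStateCut.lean` is the diagonal case `A = B`, `l = l'`.
[cite: Schollwoeck2011AnnPhys, §4.2.1 ('for a norm calculation `⟨ψ|ψ⟩`')] -/
theorem leftGram_eq_crossGram (A : Fin k → σ → Matrix χ χ ℂ) (l : χ → ℂ) :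
    leftGram A l = crossGram A A l l := rfl

/-- `C = L_A† L_B` with the left block matrices of `MatrixProductStateCut.lean`.
[cite: Schollwoeck2011AnnPhys, §4.2 second display (adjoints with reversed ordering)] -/
theorem crossGram_eq_conjTranspose_mul (A : Fin k → σ → Matrix χ χ ℂ)
    (B : Fin k → σ → Matrix χ' χ' ℂ) (l : χ → ℂ) (l' : χ' → ℂ) :
    crossGram A B l l' = (leftMat A l)ᴴ * leftMat B l' := by
  ext a b
  simp only [crossGram, leftMat, braket, Matrix.mul_apply, Matrix.conjTranspose_apply,
    Matrix.of_apply, Complex.star_def]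

omit [Fintype σ] [Fintype χ'] [DecidableEq χ'] in
/-- The empty-chain left block vector is the boundary vector itself. [folklore] -/
private theorem leftBlock_zero (A : Fin 0 → σ → Matrix χ χ ℂ) (l : χ → ℂ) (a : χ)
    (s : Fin 0 → σ) : leftBlock A l a s = l a := by
  simp [leftBlock, transfer]

/-- **`C^{(0)}`**: before any site the environment is the outer product of the two left boundary
vectors, `C^{(0)}_{a,b} = conj(l_a) l'_b` (the printed 'dummy matrix, being the scalar 1' when both
boundaries are the dummy index). [cite: Schollwoeck2011AnnPhys, §4.2.1 (`C^{[0]}`)] -/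
theorem crossGram_zero (A : Fin 0 → σ → Matrix χ χ ℂ) (B : Fin 0 → σ → Matrix χ' χ' ℂ)
    (l : χ → ℂ) (l' : χ' → ℂ) : crossGram A B l l' = vecMulVec (star l) l' := by
  ext a b
  simp [crossGram, braket, leftBlock_zero, vecMulVec_apply]

/-- **The environment recursion** `C^{(k+1)} = Σ_σ A_k(σ)† C^{(k)} B_k(σ)` — '`C^{[ℓ]} =
Σ_{σ_ℓ} M̃^{σ_ℓ†} C^{[ℓ-1]} M^{σ_ℓ}`'. [cite: Schollwoeck2011AnnPhys, §4.2.1 (first `C^{[ℓ]}`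
display); the regrouped overlap display before it] -/
theorem crossGram_succ (A : Fin (k + 1) → σ → Matrix χ χ ℂ) (B : Fin (k + 1) → σ → Matrix χ' χ' ℂ)
    (l : χ → ℂ) (l' : χ' → ℂ) :
    crossGram A B l l'
      = ∑ x : σ, (A (Fin.last k) x)ᴴ * crossGram (headSites A) (headSites B) l l'
          * B (Fin.last k) x := by
  ext a b
  rw [crossGram_eq_conjTranspose_mul, Matrix.mul_apply, Matrix.sum_apply]
  -- regroup the configurations `u : Fin (k+1) → σ` of the block as pairs `(s, x)`
  rw [← Fintype.sum_equiv (Fin.appendEquiv k 1)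
    (fun sx => (leftMat A l)ᴴ a (Fin.append sx.1 sx.2) * leftMat B l' (Fin.append sx.1 sx.2) b)
    (fun u => (leftMat A l)ᴴ a u * leftMat B l' u b) (fun _ => rfl)]
  rw [Fintype.sum_prod_type, Finset.sum_comm]
  simp only [Matrix.conjTranspose_apply, leftMat_append]
  rw [Fintype.sum_equiv (Equiv.funUnique (Fin 1) σ)
    (fun x : Fin 1 → σ => ∑ s : Fin k → σ,
      star ((leftMat (headSites A) l * A (Fin.last k) (x 0)) s a)
        * (leftMat (headSites B) l' * B (Fin.last k) (x 0)) s b)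
    (fun x0 : σ => ∑ s : Fin k → σ,
      star ((leftMat (headSites A) l * A (Fin.last k) x0) s a)
        * (leftMat (headSites B) l' * B (Fin.last k) x0) s b)
    (fun x => by simp only [Equiv.funUnique_apply, Fin.default_eq_zero])]
  refine sum_congr rfl fun x0 _ => ?_
  have h : (A (Fin.last k) x0)ᴴ * crossGram (headSites A) (headSites B) l l' * B (Fin.last k) x0
      = (leftMat (headSites A) l * A (Fin.last k) x0)ᴴ
          * (leftMat (headSites B) l' * B (Fin.last k) x0) := by
    rw [crossGram_eq_conjTranspose_mul, Matrix.conjTranspose_mul, Matrix.mul_assoc,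
      Matrix.mul_assoc, Matrix.mul_assoc]
  rw [h, Matrix.mul_apply]
  rfl

omit [Fintype σ] [Fintype χ'] [DecidableEq χ'] in
/-- An OBC amplitude is the right boundary vector contracted with the left block vectors of the
whole chain: `c_s = Σ_a |a⟩_A(s) r_a`. [cite: Schollwoeck2011AnnPhys, §4.1.3 (i)] -/
theorem amplitude_eq_sum_leftBlock {n : ℕ} (A : Fin n → σ → Matrix χ χ ℂ) (l r : χ → ℂ)
    (s : Fin n → σ) : amplitude A l r s = ∑ a, leftBlock A l a s * r a := by
  unfold amplitude leftBlock
  rw [Matrix.dotProduct_mulVec]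
  rfl

/-- **Overlap of two MPS by the environment recursion**: `⟨ψ_A|ψ_B⟩ = Σ_{a,b} conj(r_a) C^{(n)}_{a,b} r'_b
= r̄ ⬝ (C^{(n)} r')` — '`C^{[L]}` will be a scalar again, containing the result' (here with explicit
right boundary vectors). [cite: Schollwoeck2011AnnPhys, §4.2.1 (`C^{[ℓ]}` recursion, 'running ℓ
from 1 through L')] -/
theorem braket_amplitude_eq_crossGram {n : ℕ} (A : Fin n → σ → Matrix χ χ ℂ)
    (B : Fin n → σ → Matrix χ' χ' ℂ) (l r : χ → ℂ) (l' r' : χ' → ℂ) :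
    braket (amplitude A l r) (amplitude B l' r') = star r ⬝ᵥ (crossGram A B l l' *ᵥ r') := by
  -- both sides are `Σ_s Σ_a Σ_b conj(L_a(s) r_a) L'_b(s) r'_b`
  have lhs : braket (amplitude A l r) (amplitude B l' r')
      = ∑ s, ∑ a, ∑ b, star (r a) * (star (leftBlock A l a s) * leftBlock B l' b s) * r' b := by
    unfold braket
    refine sum_congr rfl fun s _ => ?_
    rw [amplitude_eq_sum_leftBlock, amplitude_eq_sum_leftBlock, map_sum, sum_mul_sum]
    refine sum_congr rfl fun a _ => sum_congr rfl fun b _ => ?_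
    rw [map_mul]
    simp only [Complex.star_def]
    ring
  have rhs : star r ⬝ᵥ (crossGram A B l l' *ᵥ r')
      = ∑ a, ∑ b, ∑ s, star (r a) * (star (leftBlock A l a s) * leftBlock B l' b s) * r' b := by
    simp only [dotProduct, Matrix.mulVec, crossGram, Matrix.of_apply, braket, Pi.star_apply,
      Complex.star_def, mul_sum, sum_mul]
    exact sum_congr rfl fun _ _ => sum_congr rfl fun _ _ => sum_congr rfl fun _ _ => by ring
  rw [lhs, rhs, sum_comm]
  exact sum_congr rfl fun a _ => sum_comm

end CrossGram

/-! ### §2 The transfer operator `E = Σ_σ conj(A(σ)) ⊗ B(σ)` -/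

section Transfer

variable {k : ℕ}

/-- The (generalised) transfer operator of site `i` for the pair `(A, B)`:
`E_i = Σ_σ conj(A_i(σ)) ⊗ₖ B_i(σ)` on `ℂ^{χ × χ'}` (entrywise conjugate, Kronecker product).
[cite: Schollwoeck2011AnnPhys, §4.2.2 display `Ê^{[ℓ]} = … Σ_{σ_ℓ} M^{[ℓ]σ_ℓ*} ⊗ M^{[ℓ]σ_ℓ} …`;
PerezGarciaVerstraeteWolfCiracQIC2007, §2.1 (`E_𝟙^{[k]} = Σ_i Ā_i^{[k]} ⊗ A_i^{[k]}`)] -/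
def transferOp {n : ℕ} (A : Fin n → σ → Matrix χ χ ℂ) (B : Fin n → σ → Matrix χ' χ' ℂ)
    (i : Fin n) : Matrix (χ × χ') (χ × χ') ℂ :=
  ∑ x : σ, (A i x).map conj ⊗ₖ B i x

/-- The vectorised environment `vec C : χ × χ' → ℂ`. [cite: Schollwoeck2011AnnPhys, §4.2.2 (the
transfer operator acts on `{|a_{ℓ-1}⟩⟨a'_{ℓ-1}|}`, i.e. on vectorised block operators)] -/
def crossGramVec (A : Fin k → σ → Matrix χ χ ℂ) (B : Fin k → σ → Matrix χ' χ' ℂ) (l : χ → ℂ)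
    (l' : χ' → ℂ) : χ × χ' → ℂ :=
  fun ab => crossGram A B l l' ab.1 ab.2

omit [Fintype σ] [DecidableEq χ] [DecidableEq χ'] in
/-- `vec(A† C B) = vec(C) ᵥ* (Ā ⊗ₖ B)` — the vectorisation identity behind the transfer operator.
[cite: Schollwoeck2011AnnPhys, §4.2.2 ('Let us formalize the iterative construction of
`C^{[ℓ]}`-matrices … transfer (super)operator')] -/
theorem conjTranspose_mul_mul_apply_eq_vecMul_kronecker (M : Matrix χ χ ℂ) (C : Matrix χ χ' ℂ)
    (N : Matrix χ' χ' ℂ) (a : χ) (b : χ') :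
    (Mᴴ * C * N) a b = ((fun ab : χ × χ' => C ab.1 ab.2) ᵥ* (M.map conj ⊗ₖ N)) (a, b) := by
  simp only [Matrix.mul_apply, Matrix.conjTranspose_apply, Matrix.vecMul, dotProduct,
    Matrix.kroneckerMap_apply, Matrix.map_apply, Complex.star_def, Fintype.sum_prod_type, sum_mul]
  rw [sum_comm]
  exact sum_congr rfl fun a' _ => sum_congr rfl fun b' _ => by ring

/-- **The environment recursion is multiplication by the transfer operator**:
`vec C^{(k+1)} = vec C^{(k)} ᵥ* E_k`. [cite: Schollwoeck2011AnnPhys, §4.2.2 (`Ê^{[ℓ]}` maps block-A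
operators of length `ℓ-1` to length `ℓ`)] -/
theorem crossGramVec_succ (A : Fin (k + 1) → σ → Matrix χ χ ℂ)
    (B : Fin (k + 1) → σ → Matrix χ' χ' ℂ) (l : χ → ℂ) (l' : χ' → ℂ) :
    crossGramVec A B l l'
      = crossGramVec (headSites A) (headSites B) l l' ᵥ* transferOp A B (Fin.last k) := by
  funext ab
  obtain ⟨a, b⟩ := ab
  simp only [crossGramVec, transferOp, Matrix.vecMul_sum, Finset.sum_apply]
  rw [crossGram_succ, Matrix.sum_apply]
  exact sum_congr rfl fun x _ => conjTranspose_mul_mul_apply_eq_vecMul_kronecker _ _ _ a b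

omit [Fintype σ] [Fintype χ] [DecidableEq χ] [Fintype χ'] [DecidableEq χ'] in
/-- `vec(l̄ l'ᵀ) = l̄ ⊗ l'` (the tree's `tensorVec`). [folklore] -/
private theorem vecMulVec_eq_tensorVec (l : χ → ℂ) (l' : χ' → ℂ) :
    (fun ab : χ × χ' => vecMulVec (star l) l' ab.1 ab.2) = tensorVec (star l) l' := by
  funext ab
  simp [vecMulVec_apply, tensorVec]

/-- **Closed form of the environment**: `vec C^{(n)} = (l̄ ⊗ l') ᵥ* (E_0 E_1 ⋯ E_{n-1})`.
[cite: Schollwoeck2011AnnPhys, §4.2.1–§4.2.2 (iterating `C^{[ℓ]}` from `ℓ = 1` through `L`);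
PerezGarciaVerstraeteWolfCiracQIC2007, §2.1 (`Π_k E^{[k]}`)] -/
theorem crossGramVec_eq_vecMul_prod :
    ∀ {n : ℕ} (A : Fin n → σ → Matrix χ χ ℂ) (B : Fin n → σ → Matrix χ' χ' ℂ) (l : χ → ℂ)
      (l' : χ' → ℂ),
      crossGramVec A B l l'
        = tensorVec (star l) l' ᵥ* (List.ofFn fun i => transferOp A B i).prod
  | 0, A, B, l, l' => by
    funext ab
    simp only [crossGramVec, crossGram_zero, List.ofFn_zero, List.prod_nil, Matrix.vecMul_one]
    rw [← vecMulVec_eq_tensorVec]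
  | k + 1, A, B, l, l' => by
    rw [crossGramVec_succ, crossGramVec_eq_vecMul_prod (headSites A) (headSites B) l l',
      Matrix.vecMul_vecMul, List.ofFn_succ', List.prod_concat]
    rfl

omit [Fintype σ] [DecidableEq χ] [DecidableEq χ'] in
/-- `r̄ ⬝ (C r') = vec C ⬝ (r̄ ⊗ r')`. [folklore] -/
private theorem star_dotProduct_mulVec (C : Matrix χ χ' ℂ) (r : χ → ℂ) (r' : χ' → ℂ) :
    star r ⬝ᵥ (C *ᵥ r') = (fun ab : χ × χ' => C ab.1 ab.2) ⬝ᵥ tensorVec (star r) r' := by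
  simp only [dotProduct, Matrix.mulVec, tensorVec, Fintype.sum_prod_type, mul_sum, Pi.star_apply]
  exact sum_congr rfl fun a _ => sum_congr rfl fun b _ => by ring

/-- **Overlap of two MPS by transfer operators**:
`⟨ψ_A|ψ_B⟩ = (l̄ ⊗ l') ⬝ (E_0 E_1 ⋯ E_{n-1}) (r̄ ⊗ r')`, `E_i = Σ_σ conj(A_i(σ)) ⊗ₖ B_i(σ)` — the
open-boundary form of '`⟨ψ|⊗_k S_k|ψ⟩ = tr[Π_k E^{[k]}_{S_k}]`' at `S_k = 𝟙`.
[cite: PerezGarciaVerstraeteWolfCiracQIC2007, §2.1 ('Normalization as well as other expectation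
values of product operators can be obtained from …'); Schollwoeck2011AnnPhys, §4.2.2] -/
theorem braket_amplitude_eq_transfer {n : ℕ} (A : Fin n → σ → Matrix χ χ ℂ)
    (B : Fin n → σ → Matrix χ' χ' ℂ) (l r : χ → ℂ) (l' r' : χ' → ℂ) :
    braket (amplitude A l r) (amplitude B l' r')
      = tensorVec (star l) l'
          ⬝ᵥ ((List.ofFn fun i => transferOp A B i).prod *ᵥ tensorVec (star r) r') := by
  rw [braket_amplitude_eq_crossGram, star_dotProduct_mulVec, Matrix.dotProduct_mulVec,
    ← crossGramVec_eq_vecMul_prod]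
  rfl

end Transfer

/-! ### §3 Operator strings: a product operator maps an MPS to an MPS with the same bonds -/

section Absorb

variable {n : ℕ}

/-- The matrix element of the operator string `⊗_i O_i` between two configurations,
`Π_i O_i(s_i, s'_i)` — the printed `O^{σ₁,σ'₁} O^{σ₂,σ'₂} ⋯ O^{σ_L,σ'_L}`.
[cite: Schollwoeck2011AnnPhys, §4.2.1 ('We are therefore considering operator matrix elements
`O^{σ₁,σ'₁} O^{σ₂,σ'₂} ⋯ O^{σ_L,σ'_L}`')] -/
def opWeight (O : Fin n → Matrix σ σ ℂ) (s s' : Fin n → σ) : ℂ := ∏ i, O i (s i) (s' i)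

/-- Absorbing the operator string into the ket tensors: `B_i(σ) ↦ Σ_{σ'} O_i(σ,σ') B_i(σ')` (for a
one-site gate this is Vidal's update `Γ'^{[l]i} = Σ_j U^i_j Γ^{[l]j}`, all other tensors unchanged:
`absorb_update_one`). [cite: Vidal2003, Lemma 1 proof display; Schollwoeck2011AnnPhys, §4.2.1
(second `C^{[ℓ]}` display, the factor `Σ_{σ'_ℓ} O^{σ_ℓ,σ'_ℓ} … M^{σ'_ℓ}`)] -/
def absorb (O : Fin n → Matrix σ σ ℂ) (B : Fin n → σ → Matrix χ' χ' ℂ) :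
    Fin n → σ → Matrix χ' χ' ℂ :=
  fun i x => ∑ y, O i x y • B i y

omit [Fintype χ] [DecidableEq χ] [Fintype χ'] [DecidableEq χ'] in
/-- **A one-site operator only transforms that site's tensor** ('Updating the description … after a
unitary operation `U` acts on qubit `l` does only involve transforming `Γ^{[l]}`'): absorbing the
string `(1,…,1,U,1,…,1)` replaces `B_i` by `σ ↦ Σ_{σ'} U(σ,σ') B_i(σ')` and leaves the other tensors
— in particular every bond index — unchanged. [cite: Vidal2003, Lemma 1] -/
theorem absorb_update_one [DecidableEq σ] (U : Matrix σ σ ℂ) (i : Fin n)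
    (B : Fin n → σ → Matrix χ' χ' ℂ) :
    absorb (Function.update (fun _ => (1 : Matrix σ σ ℂ)) i U) B
      = Function.update B i (fun x => ∑ y, U x y • B i y) := by
  funext j x
  by_cases hj : j = i
  · subst hj
    simp [absorb]
  · simp [absorb, hj, Matrix.one_apply]

omit [Fintype σ] [Fintype χ] [DecidableEq χ] in
/-- A one-site transfer product is the site matrix. [folklore] -/
private theorem transfer_one' (B : Fin 1 → σ → Matrix χ' χ' ℂ) (x : Fin 1 → σ) :
    transfer B x = B 0 (x 0) := by
  simp [transfer, List.ofFn_succ]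

omit [Fintype σ] [Fintype χ] [DecidableEq χ] [Fintype χ'] [DecidableEq χ'] in
/-- The operator-string weight factorises at a cut. [cite: Schollwoeck2011AnnPhys, §4.2.1 (the
site-by-site regrouping of the double sum)] -/
theorem opWeight_append {k m : ℕ} (O : Fin (k + m) → Matrix σ σ ℂ) (s s' : Fin k → σ)
    (t t' : Fin m → σ) :
    opWeight O (Fin.append s t) (Fin.append s' t')
      = opWeight (fun i => O (Fin.castAdd m i)) s s' * opWeight (fun j => O (Fin.natAdd k j)) t t' := by
  unfold opWeight
  rw [Fin.prod_univ_add]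
  simp only [Fin.append_left, Fin.append_right]

/-- **Product–sum interchange**: the transfer product of the absorbed tensors is the weighted sum of
the original transfer products, `Π_i (Σ_{σ'} O_i(s_i,σ') B_i(σ')) = Σ_{s'} (Π_i O_i(s_i,s'_i)) Π_i B_i(s'_i)`
— the step 'we again transpose and distribute the (now double) sum over local states'.
[cite: Schollwoeck2011AnnPhys, §4.2.1 (display
`Σ_{σ,σ'} M̃^{σ₁*}⋯M̃^{σ_L*} O^{σ₁,σ'₁}⋯O^{σ_L,σ'_L} M^{σ'₁}⋯M^{σ'_L} = …`)] -/
theorem transfer_absorb :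
    ∀ {n : ℕ} (O : Fin n → Matrix σ σ ℂ) (B : Fin n → σ → Matrix χ' χ' ℂ) (u : Fin n → σ),
      transfer (absorb O B) u = ∑ u', opWeight O u u' • transfer B u'
  | 0, O, B, u => by
    simp [transfer, opWeight]
  | k + 1, O, B, u => by
    -- write `u = s ⧺ x` with `x : Fin 1 → σ`
    have hu : u = Fin.append (fun i => u (Fin.castAdd 1 i)) (fun j => u (Fin.natAdd k j)) :=
      (Fin.append_castAdd_natAdd).symm
    rw [hu]
    set s : Fin k → σ := fun i => u (Fin.castAdd 1 i)
    set x : Fin 1 → σ := fun j => u (Fin.natAdd k j)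
    -- left-hand side: factorise at the cut and use the induction hypothesis on the first k sites
    rw [transfer_append, show headSites (absorb O B)
        = absorb (fun i => O (Fin.castAdd 1 i)) (headSites B) from rfl,
      transfer_absorb (fun i => O (Fin.castAdd 1 i)) (headSites B) s, transfer_one',
      show tailSites (absorb O B) 0 (x 0) = ∑ y, O (Fin.natAdd k 0) (x 0) y • B (Fin.natAdd k 0) y
        from rfl,
      Finset.sum_mul]
    simp_rw [Finset.mul_sum, Matrix.smul_mul, Matrix.mul_smul, smul_smul]
    -- right-hand side: regroup `u' = s' ⧺ y`
    rw [← Fintype.sum_equiv (Fin.appendEquiv k 1)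
      (fun sy => opWeight O (Fin.append s x) (Fin.append sy.1 sy.2)
        • transfer B (Fin.append sy.1 sy.2))
      (fun u' => opWeight O (Fin.append s x) u' • transfer B u') (fun _ => rfl),
      Fintype.sum_prod_type]
    refine sum_congr rfl fun s' _ => ?_
    rw [Fintype.sum_equiv (Equiv.funUnique (Fin 1) σ)
      (fun y : Fin 1 → σ => opWeight O (Fin.append s x) (Fin.append s' y)
        • transfer B (Fin.append s' y))
      (fun y0 : σ => (opWeight (fun i => O (Fin.castAdd 1 i)) s s' * O (Fin.natAdd k 0) (x 0) y0)
        • (transfer (headSites B) s' * B (Fin.natAdd k 0) y0))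
      (fun y => by
        rw [opWeight_append, transfer_append, transfer_one']
        simp only [Equiv.funUnique_apply, Fin.default_eq_zero, opWeight, Fin.prod_univ_one]
        rfl)]

/-- **An operator string maps an MPS to an MPS with the same bond index type**:
`Σ_{s'} (Π_i O_i(s_i,s'_i)) c^B_{s'} = c^{absorb O B}_s` — amplitudes of `(⊗_i O_i)|ψ_B⟩` are MPS
amplitudes with tensors `absorb O B` and the same boundary vectors. [cite: Vidal2003, Lemma 1
(one-site case); Schollwoeck2011AnnPhys, §4.2.1] -/
theorem amplitude_absorb (O : Fin n → Matrix σ σ ℂ) (B : Fin n → σ → Matrix χ' χ' ℂ)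
    (l' r' : χ' → ℂ) (s : Fin n → σ) :
    amplitude (absorb O B) l' r' s = ∑ s', opWeight O s s' * amplitude B l' r' s' := by
  unfold amplitude
  rw [transfer_absorb, Matrix.sum_mulVec, dotProduct_sum]
  exact sum_congr rfl fun s' _ => by rw [Matrix.smul_mulVec, dotProduct_smul, smul_eq_mul]

/-- **Matrix elements of operator strings are overlaps**:
`⟨ψ_A| ⊗_i O_i |ψ_B⟩ = Σ_{s,s'} conj(c^A_s) (Π_i O_i(s_i,s'_i)) c^B_{s'} = ⟨ψ_A | ψ_{absorb O B}⟩`, so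
the environment recursion / transfer-operator form of §1–§2 computes them (with `transferOp_absorb`
below: `E^O_i = Σ_{σ,σ'} O_i(σ,σ') conj(A_i(σ)) ⊗ₖ B_i(σ')`, the printed `E_S`).
[cite: Schollwoeck2011AnnPhys, §4.2.1 (second `C^{[ℓ]}` display);
PerezGarciaVerstraeteWolfCiracQIC2007, §2.1 (`⟨ψ|⊗_k S_k|ψ⟩`, `E_S^{[k]}`)] -/
theorem matrixElement_eq_braket_absorb (A : Fin n → σ → Matrix χ χ ℂ)
    (B : Fin n → σ → Matrix χ' χ' ℂ) (O : Fin n → Matrix σ σ ℂ) (l r : χ → ℂ) (l' r' : χ' → ℂ) :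
    ∑ s, ∑ s', conj (amplitude A l r s) * opWeight O s s' * amplitude B l' r' s'
      = braket (amplitude A l r) (amplitude (absorb O B) l' r') := by
  unfold braket
  refine sum_congr rfl fun s _ => ?_
  rw [amplitude_absorb, mul_sum]
  exact sum_congr rfl fun s' _ => by ring

omit [Fintype χ] [DecidableEq χ] [Fintype χ'] [DecidableEq χ'] in
/-- The transfer operator of the absorbed pair is the printed `E_S = Σ_{i,j} ⟨i|S|j⟩ Ā_i ⊗ A_j`:
`E_i(A, absorb O B) = Σ_{σ,σ'} O_i(σ,σ') • (conj(A_i(σ)) ⊗ₖ B_i(σ'))`.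
[cite: PerezGarciaVerstraeteWolfCiracQIC2007, §2.1 (definition of `E_S^{[k]}`)] -/
theorem transferOp_absorb (A : Fin n → σ → Matrix χ χ ℂ) (B : Fin n → σ → Matrix χ' χ' ℂ)
    (O : Fin n → Matrix σ σ ℂ) (i : Fin n) :
    transferOp A (absorb O B) i = ∑ x, ∑ y, O i x y • ((A i x).map conj ⊗ₖ B i y) := by
  unfold transferOp absorb
  refine sum_congr rfl fun x _ => ?_
  ext p q
  simp only [Matrix.kroneckerMap_apply, Matrix.sum_apply, Matrix.smul_apply, smul_eq_mul,
    mul_sum]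
  exact sum_congr rfl fun y _ => by ring

/-- **Expectation values / matrix elements of product operators by transfer operators**:
`⟨ψ_A| ⊗_i O_i |ψ_B⟩ = (l̄ ⊗ l') ⬝ (Π_i E^{O}_i) (r̄ ⊗ r')` with
`E^O_i = Σ_{σ,σ'} O_i(σ,σ') conj(A_i(σ)) ⊗ₖ B_i(σ')` — the open-boundary form of
'`⟨ψ|⊗_{k=1}^N S_k|ψ⟩ = tr[Π_{k=1}^N E^{[k]}_{S_k}]`'.
[cite: PerezGarciaVerstraeteWolfCiracQIC2007, §2.1; Schollwoeck2011AnnPhys, §4.2.1–§4.2.2] -/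
theorem matrixElement_eq_transfer (A : Fin n → σ → Matrix χ χ ℂ)
    (B : Fin n → σ → Matrix χ' χ' ℂ) (O : Fin n → Matrix σ σ ℂ) (l r : χ → ℂ) (l' r' : χ' → ℂ) :
    ∑ s, ∑ s', conj (amplitude A l r s) * opWeight O s s' * amplitude B l' r' s'
      = tensorVec (star l) l'
          ⬝ᵥ ((List.ofFn fun i => ∑ x, ∑ y, O i x y • ((A i x).map conj ⊗ₖ B i y)).prod
              *ᵥ tensorVec (star r) r') := by
  rw [matrixElement_eq_braket_absorb, braket_amplitude_eq_transfer]
  simp_rw [transferOp_absorb]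

end Absorb

end MPS

end Literature.Computability.QuantumComplexity
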